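import Mathlib.Combinatorics.SimpleGraph.Maps
import Mathlib.Data.Fintype.Card
import Mathlib.Data.Fintype.Prod
import Mathlib.Data.Prod.Lex
import Mathlib.Order.PiLex
import Mathlib.Algebra.BigOperators.Group.Finset.Basic
import Literature.Combinatorics.SimpleGraph.ColourRefinement
import HarnessLib

/-!
# Ordered colour refinement: colour refinement with canonically ORDERED colours

Colour refinement (`ColourRefinement.lean`: the rounds `crRel G i` as RELATIONS) computes a
partition but no order on its classes. The classical algorithm does more: the new colour of a
vertex is the pair (old colour, multiset of old colours of its neighbours) and colours are
RENAMED by sorting, so that at every round the colours are `0, 1, 2, …` in a canonical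
(isomorphism-invariant) linear order — "we may assume the colors are integers … sort the new
colors lexicographically and rename them" (Cai–Fürer–Immerman 1992, §5; Immerman–Lander 1990,
§1.8–1.9, where this ordered refinement yields a canonical labelling of every graph whose stable
colouring is discrete, Thm 1.9.4; Kiefer–McKay 2020, Def. 3). This file formalises the ordered
rounds with colours in `ℕ`:

* `nbrCount G col u c` — the number of neighbours of `u` of colour `c` under `col : V → ℕ`;
* `KeyLT G col u v` — the refinement-and-sort comparison: `col u < col v`, or `col u = col v` and
  the vector of neighbour counts of `u` (indexed by the colours, in increasing order) is
  lexicographically smaller than that of `v` (first difference at the least colour);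
* `ocrStep G col u = #{v | KeyLT G col v u}` — the new colour of `u` is the NUMBER OF VERTICES
  with a smaller key (competition ranking: equal keys get equal colours, and the order of the
  new colours is the order of the keys, `ocrStep_lt_iff`, `ocrStep_eq_iff`);
* `ocr G t` — round `t` of ordered colour refinement from the uniform colouring `0`.

Main results: the kernel of `ocr G t` is exactly the relational round `crRel G t`
(`ocr_eq_iff_crRel`), so `ocr` is colour refinement with a canonical order on the classes; the
order at round `t + 1` unfolds to first-order-with-counting clauses over round `t`
(`ocr_succ_lt_iff`, `ocr_succ_eq_iff` — the form a threshold circuit evaluates). Stabilisation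
within `|V| - 1` rounds, injectivity on CR-discrete graphs and the resulting canonical labelling
are in `ColourRefinementCanonical.lean`.

## References

* [CaiFurerImmerman1992] J.-Y. Cai, M. Fürer, N. Immerman, *An optimal lower bound on the number
  of variables for graph identification*, Combinatorica 12 (1992), §5 (vertex refinement with
  sorted integer colours; "at most n iterations").
* [ImmermanLander1990] N. Immerman, E. Lander, *Describing graphs: a first-order approach to graph
  canonization* (1990), §1.8–1.9, Thm 1.9.4 (canonical labelling from the stable colouring).
* [KieferMcKay2020] S. Kiefer, B. D. McKay, *The iteration number of colour refinement*, ICALP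
  2020, Def. 3, Cor. 6.
-/

namespace Literature.Combinatorics.SimpleGraph

open _root_.SimpleGraph Finset

universe u

variable {V : Type u} [Fintype V]

/-! ## Ranks with respect to a linearly ordered labelling -/

section Rank

variable {α : Type*} [LinearOrder α] (f : V → α)

/-- The **competition rank** of `u` under the labelling `f`: the number of `v` with
`f v < f u`. [folklore] -/
def rankOf (u : V) : ℕ := (univ.filter fun v => f v < f u).card

/-- A smaller label has a smaller rank. [folklore] -/
theorem rankOf_lt_rankOf {u v : V} (h : f u < f v) : rankOf f u < rankOf f v := by
  unfold rankOf
  apply Finset.card_lt_card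
  rw [Finset.ssubset_iff_of_subset]
  · exact ⟨u, by simp [h], by simp⟩
  · intro w hw
    simp only [mem_filter, mem_univ, true_and] at hw ⊢
    exact hw.trans h

/-- Equal labels have equal ranks. [folklore] -/
theorem rankOf_eq_rankOf {u v : V} (h : f u = f v) : rankOf f u = rankOf f v := by
  unfold rankOf
  rw [h]

/-- **Ranks are ordered as labels.** [folklore] -/
theorem rankOf_lt_iff {u v : V} : rankOf f u < rankOf f v ↔ f u < f v := by
  refine ⟨fun h => ?_, rankOf_lt_rankOf f⟩
  rcases lt_trichotomy (f u) (f v) with h' | h' | h'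
  · exact h'
  · rw [rankOf_eq_rankOf f h'] at h
    exact (lt_irrefl _ h).elim
  · exact (lt_asymm h (rankOf_lt_rankOf f h')).elim

/-- **Ranks are equal iff labels are.** [folklore] -/
theorem rankOf_eq_iff {u v : V} : rankOf f u = rankOf f v ↔ f u = f v := by
  refine ⟨fun h => ?_, rankOf_eq_rankOf f⟩
  rcases lt_trichotomy (f u) (f v) with h' | h' | h'
  · exact absurd h (rankOf_lt_rankOf f h').ne
  · exact h'
  · exact absurd h (rankOf_lt_rankOf f h').ne'

/-- Ranks compare (weakly) as labels. [folklore] -/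
theorem rankOf_le_iff {u v : V} : rankOf f u ≤ rankOf f v ↔ f u ≤ f v := by
  rw [← not_lt, rankOf_lt_iff, not_lt]

/-- Ranks are `< |V|`. [folklore] -/
theorem rankOf_lt_card (u : V) : rankOf f u < Fintype.card V := by
  unfold rankOf
  rw [← Finset.card_univ]
  apply Finset.card_lt_card
  rw [Finset.ssubset_iff_of_subset (Finset.filter_subset _ _)]
  exact ⟨u, mem_univ u, by simp⟩

/-- For an INJECTIVE labelling the rank of `u` determines `u`. [folklore] -/
theorem rankOf_injective (hf : Function.Injective f) : Function.Injective (rankOf f) :=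
  fun _ _ h => hf ((rankOf_eq_iff f).1 h)

end Rank

/-! ## One round of ordered refinement -/

section Step

variable (G : _root_.SimpleGraph V) [DecidableRel G.Adj] (col : V → ℕ)

/-- The number of neighbours of `u` whose colour (under `col`) is `c`. [cite: CaiFurerImmerman1992, §5 (vertex refinement)] -/
def nbrCount (u : V) (c : ℕ) : ℕ := (univ.filter fun w => G.Adj u w ∧ col w = c).card

/-- The **lexicographic comparison of neighbour-count vectors**: at the least colour where the
counts of `u` and `v` differ, `u` has fewer neighbours (colours are compared in increasing
order; only colours actually worn matter, the other counts being `0`). [cite: CaiFurerImmerman1992, §5 ("sort these new colors lexicographically")] -/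
def ProfLT (u v : V) : Prop :=
  ∃ w : V, nbrCount G col u (col w) < nbrCount G col v (col w) ∧
    ∀ w' : V, col w' < col w → nbrCount G col u (col w') = nbrCount G col v (col w')

/-- The **refinement key order**: first by old colour, then lexicographically by the vector of
neighbour counts. [cite: CaiFurerImmerman1992, §5 (vertex refinement)] -/
def KeyLT (u v : V) : Prop := col u < col v ∨ (col u = col v ∧ ProfLT G col u v)

/-- `ProfLT` is decidable (a finite search). [folklore] -/
instance ProfLT.decidableRel : DecidableRel (ProfLT G col) := fun u v => by
  unfold ProfLT; infer_instance

/-- `KeyLT` is decidable. [folklore] -/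
instance KeyLT.decidableRel : DecidableRel (KeyLT G col) := fun u v => by
  unfold KeyLT; infer_instance

/-- **One round of ordered colour refinement**: the new colour of `u` is the number of
vertices with a smaller key ("rename the sorted new colours `0, 1, 2, …`", with ties sharing a
name). [cite: CaiFurerImmerman1992, §5 (vertex refinement)] -/
def ocrStep (u : V) : ℕ := (univ.filter fun v => KeyLT G col v u).card

/-- The key of a vertex as an element of a LINEAR ORDER (proof device): the old colour, then the
count vector `ℕ → ℕ` in the lexicographic order of functions out of the well-order `ℕ`.
[folklore] -/
noncomputable def ocrKey (u : V) : Lex (ℕ × Lex (ℕ → ℕ)) :=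
  toLex (col u, toLex (nbrCount G col u))

variable {G col}

/-- A colour worn by no vertex is counted `0` times. [folklore] -/
theorem nbrCount_eq_zero_of_forall_ne {c : ℕ} (hc : ∀ w, col w ≠ c) (u : V) :
    nbrCount G col u c = 0 := by
  unfold nbrCount
  rw [Finset.card_eq_zero, Finset.filter_eq_empty_iff]
  exact fun w _ hw => hc w hw.2

/-- A positive count is witnessed by a neighbour of that colour. [folklore] -/
theorem exists_of_nbrCount_pos {u : V} {c : ℕ} (h : 0 < nbrCount G col u c) :
    ∃ w, G.Adj u w ∧ col w = c := by
  unfold nbrCount at h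
  obtain ⟨w, hw⟩ := Finset.card_pos.1 h
  simp only [mem_filter, mem_univ, true_and] at hw
  exact ⟨w, hw⟩

/-- The lexicographic count comparison is the order of the count vectors in `Lex (ℕ → ℕ)`.
[folklore] -/
theorem profLT_iff_toLex_lt {u v : V} :
    ProfLT G col u v ↔ toLex (nbrCount G col u) < toLex (nbrCount G col v) := by
  change _ ↔ Pi.Lex (· < ·) (· < ·) (nbrCount G col u) (nbrCount G col v)
  constructor
  · rintro ⟨w, hlt, hall⟩
    refine ⟨col w, fun c' hc' => ?_, hlt⟩
    by_cases h : ∃ w', col w' = c'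
    · obtain ⟨w', rfl⟩ := h
      exact hall w' hc'
    · push Not at h
      rw [nbrCount_eq_zero_of_forall_ne h, nbrCount_eq_zero_of_forall_ne h]
  · rintro ⟨c, hall, hlt⟩
    obtain ⟨w, -, rfl⟩ := exists_of_nbrCount_pos (lt_of_le_of_lt (Nat.zero_le _) hlt)
    exact ⟨w, hlt, fun w' hw' => hall _ hw'⟩

/-- **The key order is the order of `ocrKey`.** [folklore] -/
theorem keyLT_iff_ocrKey_lt {u v : V} : KeyLT G col u v ↔ ocrKey G col u < ocrKey G col v := by
  unfold KeyLT ocrKey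
  rw [Prod.Lex.toLex_lt_toLex, profLT_iff_toLex_lt]

/-- Equality of keys: same colour and the same number of neighbours of every colour.
[folklore] -/
theorem ocrKey_eq_iff {u v : V} :
    ocrKey G col u = ocrKey G col v ↔ col u = col v ∧ ∀ c, nbrCount G col u c = nbrCount G col v c := by
  unfold ocrKey
  rw [toLex_inj, Prod.mk.injEq, toLex_inj, funext_iff]

/-- Equality of keys, tested only on colours worn by vertices. [folklore] -/
theorem ocrKey_eq_iff' {u v : V} :
    ocrKey G col u = ocrKey G col v ↔
      col u = col v ∧ ∀ w, nbrCount G col u (col w) = nbrCount G col v (col w) := by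
  rw [ocrKey_eq_iff]
  refine and_congr_right fun _ => ⟨fun h w => h (col w), fun h c => ?_⟩
  by_cases hc : ∃ w, col w = c
  · obtain ⟨w, rfl⟩ := hc
    exact h w
  · push Not at hc
    rw [nbrCount_eq_zero_of_forall_ne hc, nbrCount_eq_zero_of_forall_ne hc]

/-- `ocrStep` is the competition rank of the key. [folklore] -/
theorem ocrStep_eq_rankOf (u : V) : ocrStep G col u = rankOf (ocrKey G col) u := by
  unfold ocrStep rankOf
  congr 1
  ext v
  simp only [mem_filter, mem_univ, true_and, keyLT_iff_ocrKey_lt]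

/-- **The new colours are ordered as the keys.** [cite: CaiFurerImmerman1992, §5 (vertex refinement)] -/
theorem ocrStep_lt_iff {u v : V} : ocrStep G col u < ocrStep G col v ↔ KeyLT G col u v := by
  rw [ocrStep_eq_rankOf, ocrStep_eq_rankOf, rankOf_lt_iff, keyLT_iff_ocrKey_lt]

/-- **Two vertices get the same new colour iff they have the same old colour and equally many
neighbours of each old colour.** [cite: CaiFurerImmerman1992, §5 (vertex refinement)] -/
theorem ocrStep_eq_iff {u v : V} :
    ocrStep G col u = ocrStep G col v ↔
      col u = col v ∧ ∀ w, nbrCount G col u (col w) = nbrCount G col v (col w) := by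
  rw [ocrStep_eq_rankOf, ocrStep_eq_rankOf, rankOf_eq_iff, ocrKey_eq_iff']

/-- The key order is irreflexive. [folklore] -/
theorem keyLT_irrefl (u : V) : ¬ KeyLT G col u u := by
  rw [keyLT_iff_ocrKey_lt]; exact lt_irrefl _

/-- The key order is transitive. [folklore] -/
theorem KeyLT.trans {u v w : V} (h : KeyLT G col u v) (h' : KeyLT G col v w) : KeyLT G col u w := by
  rw [keyLT_iff_ocrKey_lt] at h h' ⊢; exact h.trans h'

/-- Trichotomy of the key order relative to "same new colour". [folklore] -/
theorem keyLT_or_eq_or_gt (u v : V) :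
    KeyLT G col u v ∨ ocrStep G col u = ocrStep G col v ∨ KeyLT G col v u := by
  rw [keyLT_iff_ocrKey_lt, keyLT_iff_ocrKey_lt, ocrStep_eq_rankOf, ocrStep_eq_rankOf, rankOf_eq_iff]
  exact lt_trichotomy _ _

/-- The new colouring refines the old one. [cite: KieferMcKay2020, §3 (π(χⁱ⁻¹) ⪰ π(χⁱ))] -/
theorem eq_of_ocrStep_eq {u v : V} (h : ocrStep G col u = ocrStep G col v) : col u = col v :=
  (ocrStep_eq_iff.1 h).1

/-- A smaller old colour gives a smaller new colour. [folklore] -/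
theorem ocrStep_lt_of_lt {u v : V} (h : col u < col v) : ocrStep G col u < ocrStep G col v :=
  ocrStep_lt_iff.2 (Or.inl h)

/-- Hence the new colouring is weakly monotone in the old one. [folklore] -/
theorem le_of_ocrStep_le {u v : V} (h : ocrStep G col u ≤ ocrStep G col v) : col u ≤ col v := by
  by_contra hlt
  exact absurd h (not_le.2 (ocrStep_lt_of_lt (not_le.1 hlt)))

/-- New colours are `< |V|`. [folklore] -/
theorem ocrStep_lt_card (u : V) : ocrStep G col u < Fintype.card V := by
  rw [ocrStep_eq_rankOf]; exact rankOf_lt_card _ u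

/-- The counts of `u` depend on `col` only through its kernel, up to renaming colours: if `col'`
has the same kernel as `col` then `nbrCount` agree at corresponding colours. [folklore] -/
theorem nbrCount_congr_ker {col' : V → ℕ} (h : ∀ a b : V, col a = col b ↔ col' a = col' b)
    (u w : V) : nbrCount G col u (col w) = nbrCount G col' u (col' w) := by
  unfold nbrCount
  congr 1
  ext x
  simp only [mem_filter, mem_univ, true_and, h x w]

/-- Hence `ocrStep` depends on `col` only through its kernel and the ORDER of its colours.
[folklore] -/
theorem ocrStep_congr {col' : V → ℕ} (hk : ∀ a b : V, col a = col b ↔ col' a = col' b)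
    (ho : ∀ a b : V, col a < col b ↔ col' a < col' b) (u : V) :
    ocrStep G col u = ocrStep G col' u := by
  unfold ocrStep
  congr 1
  ext v
  simp only [mem_filter, mem_univ, true_and, KeyLT, ProfLT, hk, ho,
    nbrCount_congr_ker hk]

end Step

/-! ## The rounds of ordered colour refinement -/

section Rounds

variable (G : _root_.SimpleGraph V) [DecidableRel G.Adj]

/-- **Ordered colour refinement, round `t`**, from the uniform colouring `0`. [cite: CaiFurerImmerman1992, §5 (vertex refinement)] -/
def ocr : ℕ → V → ℕ
  | 0 => fun _ => 0
  | t + 1 => ocrStep G (ocr t)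

variable {G}

/-- Round `0` is uniform. [folklore] -/
@[simp] theorem ocr_zero (u : V) : ocr G 0 u = 0 := rfl

/-- Round `t + 1` is one step from round `t`. [folklore] -/
theorem ocr_succ (t : ℕ) : ocr G (t + 1) = ocrStep G (ocr G t) := rfl

/-- **The order at round `t + 1`, unfolded** (the clause a circuit evaluates): `u` precedes `v`
iff it did at round `t`, or they were tied and, at the least round-`t` colour class where their
neighbour counts differ, `u` has fewer neighbours. [cite: CaiFurerImmerman1992, §5 (vertex refinement)] -/
theorem ocr_succ_lt_iff (t : ℕ) (u v : V) :
    ocr G (t + 1) u < ocr G (t + 1) v ↔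
      ocr G t u < ocr G t v ∨ (ocr G t u = ocr G t v ∧
        ∃ w : V, nbrCount G (ocr G t) u (ocr G t w) < nbrCount G (ocr G t) v (ocr G t w) ∧
          ∀ w' : V, ocr G t w' < ocr G t w →
            nbrCount G (ocr G t) u (ocr G t w') = nbrCount G (ocr G t) v (ocr G t w')) :=
  ocrStep_lt_iff

/-- **Equality at round `t + 1`, unfolded**: same round-`t` colour and the same number of
neighbours in every round-`t` class. [cite: CaiFurerImmerman1992, §5 (vertex refinement)] -/
theorem ocr_succ_eq_iff (t : ℕ) (u v : V) :
    ocr G (t + 1) u = ocr G (t + 1) v ↔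
      ocr G t u = ocr G t v ∧
        ∀ w : V, nbrCount G (ocr G t) u (ocr G t w) = nbrCount G (ocr G t) v (ocr G t w) :=
  ocrStep_eq_iff

/-- Later rounds refine earlier ones. [cite: KieferMcKay2020, §3 (π(χⁱ⁻¹) ⪰ π(χⁱ))] -/
theorem ocr_eq_of_succ_eq {t : ℕ} {u v : V} (h : ocr G (t + 1) u = ocr G (t + 1) v) :
    ocr G t u = ocr G t v :=
  eq_of_ocrStep_eq h

/-- Later rounds refine earlier ones (any gap). [folklore] -/
theorem ocr_eq_of_le {s t : ℕ} (hst : s ≤ t) {u v : V} (h : ocr G t u = ocr G t v) :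
    ocr G s u = ocr G s v := by
  induction t, hst using Nat.le_induction with
  | base => exact h
  | succ t _ ih => exact ih (ocr_eq_of_succ_eq h)

/-- Colours at every round are `< |V|` (for nonempty `V`; at round `0` they are `0`). [folklore] -/
theorem ocr_lt_card [Nonempty V] (t : ℕ) (u : V) : ocr G t u < Fintype.card V := by
  cases t with
  | zero => exact Fintype.card_pos
  | succ t => exact ocrStep_lt_card u

/-- `Nat.card` of a subtype of a `Fintype` is the cardinality of the filtered `univ`. [folklore] -/
theorem natCard_subtype_eq_card_filter' (p : V → Prop) [DecidablePred p] :
    Nat.card {x : V // p x} = (univ.filter p).card :=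
  Nat.subtype_card _ (by simp)

/-- **Ordered colour refinement IS colour refinement**: two vertices have the same colour at
round `t` iff they are equivalent in the relational round `crRel G t`. [cite: CaiFurerImmerman1992, §5 (vertex refinement)] -/
theorem ocr_eq_iff_crRel : ∀ (t : ℕ) (u v : V), ocr G t u = ocr G t v ↔ crRel G t u v
  | 0, u, v => by simp
  | t + 1, u, v => by
    classical
    rw [ocr_succ_eq_iff, crRel_succ_iff, ocr_eq_iff_crRel t u v]
    refine and_congr_right fun _ => forall_congr' fun w => ?_
    have key : ∀ a : V, Nat.card {x : V // G.Adj a x ∧ crRel G t w x} =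
        nbrCount G (ocr G t) a (ocr G t w) := by
      intro a
      rw [natCard_subtype_eq_card_filter', nbrCount]
      congr 1
      ext x
      simp only [mem_filter, mem_univ, true_and, ← ocr_eq_iff_crRel t w x, eq_comm]
    rw [key u, key v]

end Rounds

end Literature.Combinatorics.SimpleGraph
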